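import Summits.AtomisticToContinuum.HydrodynamicLimit.Theorems.CollisionIsometryCLTCollisionalTransferLocalityDefsC
import Literature.Analysis.FunctionSpaces.TorusCalculusProofs
import Literature.Analysis.FunctionSpaces.TorusSpaceTime
import Literature.Analysis.FluidPDE.HardSphereRegularGeometry
import HarnessLib

/-!
# [A'-kin], part 1: pair kinematics of an ordered contact pair and a Taylor estimate along lines on `𝕋³`
(line `hemisphere-affine-slaving`, crux `CollisionalTransferLocality`, stmt-AtomisticToContinuum-9518)

Helper file (`--supports stmt-AtomisticToContinuum-9518`; registered stub `jumpK_add_jumpK_swap`) of the line lead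
(gen 1, seat c2). Deterministic ingredients of the flux form of the collision-jump sum:

* `hasDerivAt_lineMap(_sum)`, `abs_taylor_line_le`, `abs_sym_taylor_le` — calculus along the line
  `θ ↦ x + proj (θ n)` on `𝕋³`: the derivative is `Σ_a n_a ∂_a f`, and if all second partial derivatives of the
  smooth scalar `f` are bounded by `C₂` then `|f(x + proj n) − f(x) − Σ_a n_a ∂_a f(x)| ≤ C₂ (Σ_a |n_a|)²`
  (mean value theorem twice) and the symmetric form `|2(f x' − f x) − Σ_a n_a (∂_a f x' + ∂_a f x)| ≤ 2 C₂ (Σ|n_a|)²`;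
* pair kinematics read off `dV`/`dE` (elastic reflection at `n = x_i − x_j`): `Δv_i = ⟪g, ω⟫ ω`, `‖Δv_i‖ = |⟪g, ω⟫|`,
  `Δ(|v_i|²/2) = ⟪g, ω⟫ ⟪V, ω⟫` (`g = v_i − v_j`, `V = (v_i + v_j)/2`, `ω = n/‖n‖`), `x_i = x_j + proj n`, and for a
  pair at minimal-image distance `< 1/2` the swap identities `n_{ji} = −n_{ij}`, `Δv_j = −Δv_i`, `Δ(|v_j|²/2) = −Δ(|v_i|²/2)`;
* `jumpK_add_jumpK_swap` (registered) — THE JUMP OF THE PAIR: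
  `jumpK i j + jumpK j i = ⟪g, ω⟫ (⟪ψ(x_i) − ψ(x_j), ω⟫ + (χ(x_i) − χ(x_j)) ⟪V, ω⟫)`;
* `markK_add_markK_swap` — the mark of the pair: `markK i j + markK j i = (ε_N/2)‖Δv_i‖ (m(x_i) + m(x_j))`.
References: Cercignani–Illner–Pulvirenti (1994) §4.2 (elastic reflection); Spohn (1991) Part I §3.2.
-/

namespace Summit.AtomisticToContinuum.HydrodynamicLimit.Theorems.HemisphereAffineSlaving

open scoped BigOperators Topology Classical ENNReal InnerProductSpace
open Filter Set Function MeasureTheory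
open Literature.Analysis.FunctionSpaces Literature.Analysis.FluidPDE

noncomputable section

open Literature.MathematicalPhysics.KineticTheory (T3 V3 hsDiameter)

/-! ## A second-order Taylor estimate along lines on `𝕋³` -/

section Taylor

/-- Derivative along a line: `θ ↦ f (x + proj (θ • n))` has derivative `Df(x + proj(θ n)) n`. -/
theorem hasDerivAt_lineMap {F' : Type*} [NormedAddCommGroup F'] [NormedSpace ℝ F'] {f : T3 → F'}
    (hf : Torus.IsContDiff 1 f) (x : T3) (n : V3) (θ : ℝ) :
    HasDerivAt (fun θ : ℝ => f (x + Torus.proj (θ • n)))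
      (Torus.fderiv f (x + Torus.proj (θ • n)) n) θ := by
  obtain ⟨y, rfl⟩ := Torus.proj_surjective x
  have hfun : (fun θ : ℝ => f (Torus.proj y + Torus.proj (θ • n))) =
      Torus.lift f ∘ fun θ : ℝ => y + θ • n := by
    funext θ
    simp [Torus.lift_apply, Torus.proj_add]
  rw [hfun, ← Torus.proj_add, ← Torus.fderiv_lift]
  have hd : DifferentiableAt ℝ (Torus.lift f) (y + θ • n) :=
    ((hf : ContDiff ℝ 1 (Torus.lift f)).differentiable one_ne_zero).differentiableAt
  have hline : HasDerivAt (fun θ : ℝ => y + θ • n) n θ := by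
    simpa using (hasDerivAt_id θ).smul_const n |>.const_add y
  exact hd.hasFDerivAt.comp_hasDerivAt θ hline

/-- Derivative along a line in partial derivatives: `d/dθ f(x + proj(θ n)) = Σ_a n_a ∂_a f (x + proj(θ n))`
for scalar `C¹` `f`. -/
theorem hasDerivAt_lineMap_sum {f : T3 → ℝ} (hf : Torus.IsContDiff 1 f) (x : T3) (n : V3) (θ : ℝ) :
    HasDerivAt (fun θ : ℝ => f (x + Torus.proj (θ • n)))
      (∑ a, n a * Torus.partialDeriv a f (x + Torus.proj (θ • n))) θ := by
  have h := hasDerivAt_lineMap hf x n θ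
  rw [Torus.fderiv_apply_eq_sum_partialDeriv hf] at h
  simpa only [smul_eq_mul] using h

/-- **Second-order Taylor estimate along a line on `𝕋³`.** If all second partial derivatives of the
smooth scalar `f` are bounded by `C₂`, then `|f(x + proj n) − f(x) − Σ_a n_a ∂_a f(x)| ≤ C₂ (Σ_a |n_a|)²`
(mean value theorem twice; the constant is not optimal). -/
theorem abs_taylor_line_le {f : T3 → ℝ} (hf : Torus.IsSmooth f) {C₂ : ℝ}
    (hC : ∀ a b y, |Torus.partialDeriv a (Torus.partialDeriv b f) y| ≤ C₂) (x : T3) (n : V3) :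
    |f (x + Torus.proj n) - f x - ∑ a, n a * Torus.partialDeriv a f x| ≤
      C₂ * (∑ a, |n a|) ^ 2 := by
  have hf1 : Torus.IsContDiff 1 f := hf.isContDiff (by simp)
  have hC0 : 0 ≤ C₂ := (abs_nonneg _).trans (hC 0 0 x)
  set S : ℝ := ∑ a, |n a| with hS
  have hS0 : 0 ≤ S := Finset.sum_nonneg fun a _ => abs_nonneg _
  -- the function along the line and its derivative
  set g : ℝ → ℝ := fun θ => f (x + Torus.proj (θ • n)) with hg
  set p : Fin 3 → ℝ → ℝ := fun a θ => Torus.partialDeriv a f (x + Torus.proj (θ • n)) with hp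
  set g' : ℝ → ℝ := fun θ => ∑ a, n a * p a θ with hg'
  have hgd : ∀ θ, HasDerivAt g (g' θ) θ := fun θ => hasDerivAt_lineMap_sum hf1 x n θ
  -- each `p a` is Lipschitz with constant `C₂ S` along the line
  have hpd : ∀ a θ, HasDerivAt (p a)
      (∑ b, n b * Torus.partialDeriv b (Torus.partialDeriv a f) (x + Torus.proj (θ • n))) θ :=
    fun a θ => hasDerivAt_lineMap_sum ((hf.partialDeriv a).isContDiff (by simp)) x n θ
  have hpLip : ∀ a, ∀ θ ∈ Icc (0 : ℝ) 1, |p a θ - p a 0| ≤ C₂ * S * θ := by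
    intro a θ hθ
    have hbound : ∀ ξ ∈ Ico (0 : ℝ) 1,
        ‖∑ b, n b * Torus.partialDeriv b (Torus.partialDeriv a f) (x + Torus.proj (ξ • n))‖ ≤ C₂ * S := by
      intro ξ _
      rw [Real.norm_eq_abs, hS, Finset.mul_sum]
      refine (Finset.abs_sum_le_sum_abs _ _).trans (Finset.sum_le_sum fun b _ => ?_)
      rw [abs_mul, mul_comm]
      exact mul_le_mul_of_nonneg_right (hC b a _) (abs_nonneg _)
    have h := norm_image_sub_le_of_norm_deriv_le_segment' (f := p a)
      (fun ξ _ => (hpd a ξ).hasDerivWithinAt) hbound θ hθ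
    rw [Real.norm_eq_abs, sub_zero] at h
    exact h
  -- mean value theorem for `g` on `[0, 1]`
  have hgc : ContinuousOn g (Icc 0 1) := fun θ _ => (hgd θ).continuousAt.continuousWithinAt
  obtain ⟨ξ, hξ, hslope⟩ := exists_hasDerivAt_eq_slope g g' zero_lt_one hgc (fun θ _ => hgd θ)
  rw [sub_zero, div_one] at hslope
  -- assemble
  have hg1 : g 1 = f (x + Torus.proj n) := by simp [hg]
  have hg0 : g 0 = f x := by simp [hg]
  have hg'0 : g' 0 = ∑ a, n a * Torus.partialDeriv a f x := by simp [hg', hp]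
  have hkey : f (x + Torus.proj n) - f x - ∑ a, n a * Torus.partialDeriv a f x = g' ξ - g' 0 := by
    rw [← hg1, ← hg0, ← hg'0, hslope]
  rw [hkey, hg']
  simp only
  rw [← Finset.sum_sub_distrib]
  calc |∑ a, (n a * p a ξ - n a * p a 0)| ≤ ∑ a, |n a * p a ξ - n a * p a 0| :=
        Finset.abs_sum_le_sum_abs _ _
    _ = ∑ a, |n a| * |p a ξ - p a 0| := by
        refine Finset.sum_congr rfl fun a _ => ?_
        rw [← mul_sub, abs_mul]
    _ ≤ ∑ a, |n a| * (C₂ * S) := by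
        refine Finset.sum_le_sum fun a _ => mul_le_mul_of_nonneg_left ?_ (abs_nonneg _)
        have h1 := hpLip a ξ (Ioo_subset_Icc_self hξ)
        have hξ1 : C₂ * S * ξ ≤ C₂ * S := mul_le_of_le_one_right (by positivity) hξ.2.le
        exact h1.trans hξ1
    _ = C₂ * S ^ 2 := by rw [← Finset.sum_mul, ← hS]; ring

/-- The symmetric form used pair by pair: for `x' = x + proj n`,
`|2(f x' − f x) − Σ_a n_a (∂_a f x' + ∂_a f x)| ≤ 2 C₂ (Σ_a |n_a|)²`. -/
theorem abs_sym_taylor_le {f : T3 → ℝ} (hf : Torus.IsSmooth f) {C₂ : ℝ}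
    (hC : ∀ a b y, |Torus.partialDeriv a (Torus.partialDeriv b f) y| ≤ C₂) (x : T3) (n : V3) :
    |2 * (f (x + Torus.proj n) - f x) -
        ∑ a, n a * (Torus.partialDeriv a f (x + Torus.proj n) + Torus.partialDeriv a f x)| ≤
      2 * C₂ * (∑ a, |n a|) ^ 2 := by
  have h1 := abs_taylor_line_le hf hC x n
  have h2 := abs_taylor_line_le hf hC (x + Torus.proj n) (-n)
  have hx : x + Torus.proj n + Torus.proj (-n) = x := by
    rw [Torus.proj_neg, add_neg_cancel_right]
  rw [hx] at h2
  have hsum : (∑ a, |(-n) a|) = ∑ a, |n a| := Finset.sum_congr rfl fun a _ => by simp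
  rw [hsum] at h2
  have hkey : 2 * (f (x + Torus.proj n) - f x) -
      ∑ a, n a * (Torus.partialDeriv a f (x + Torus.proj n) + Torus.partialDeriv a f x) =
      (f (x + Torus.proj n) - f x - ∑ a, n a * Torus.partialDeriv a f x) -
        (f x - f (x + Torus.proj n) - ∑ a, (-n) a * Torus.partialDeriv a f (x + Torus.proj n)) := by
    simp only [PiLp.neg_apply, neg_mul, Finset.sum_neg_distrib, mul_add, Finset.sum_add_distrib]
    ring
  rw [hkey]
  calc _ ≤ |f (x + Torus.proj n) - f x - ∑ a, n a * Torus.partialDeriv a f x| +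
        |f x - f (x + Torus.proj n) - ∑ a, (-n) a * Torus.partialDeriv a f (x + Torus.proj n)| :=
        abs_sub _ _
    _ ≤ C₂ * (∑ a, |n a|) ^ 2 + C₂ * (∑ a, |n a|) ^ 2 := add_le_add h1 h2
    _ = 2 * C₂ * (∑ a, |n a|) ^ 2 := by ring

end Taylor

/-! ## Collision kinematics of an ordered pair -/

section PairKinematics

variable {N : ℕ} (w : Cfg N) (i j : Fin (N + 1))

/-- `Δv_i = (⟪g, n⟫/‖n‖²) n` with `g = v_i − v_j`, `n = x_i − x_j`. -/
theorem dV_eq_smul_sepV :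
    dV N w i j = (⟪(w i).2 - (w j).2, sepV N w i j⟫_ℝ / ‖sepV N w i j‖ ^ 2) • sepV N w i j := by
  simp only [dV, reflectVel, sepV]
  abel_nf

/-- `Δv_i = ⟪g, ω⟫ ω` with the unit normal `ω = n/‖n‖`. -/
theorem dV_eq_smul_omg : dV N w i j = ⟪(w i).2 - (w j).2, omg N w i j⟫_ℝ • omg N w i j := by
  rw [dV_eq_smul_sepV, omg, inner_smul_right, smul_smul]
  congr 1
  rw [div_eq_mul_inv, ← inv_pow, sq]
  ring

/-- The unit normal has norm `1` off the diagonal junk `n = 0`. -/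
theorem norm_omg {w : Cfg N} {i j : Fin (N + 1)} (hn : sepV N w i j ≠ 0) : ‖omg N w i j‖ = 1 := by
  rw [omg, norm_smul, norm_inv, norm_norm, inv_mul_cancel₀ (norm_ne_zero_iff.2 hn)]

/-- `‖Δv_i‖ = |⟪g, ω⟫|` off the junk `n = 0`. -/
theorem norm_dV_eq {w : Cfg N} {i j : Fin (N + 1)} (hn : sepV N w i j ≠ 0) :
    ‖dV N w i j‖ = |⟪(w i).2 - (w j).2, omg N w i j⟫_ℝ| := by
  rw [dV_eq_smul_omg, norm_smul, norm_omg hn, mul_one, Real.norm_eq_abs]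

/-- `Δ(|v_i|²/2) = ⟪g, ω⟫ ⟪V, ω⟫` with `V = (v_i + v_j)/2` (also at the junk `n = 0`, both sides `0`). -/
theorem dE_eq_mul_inner :
    dE N w i j = ⟪(w i).2 - (w j).2, omg N w i j⟫_ℝ * ⟪Vcm N w i j, omg N w i j⟫_ℝ := by
  by_cases hn : sepV N w i j = 0
  · have h1 : omg N w i j = 0 := by simp [omg, hn]
    have h2 : dE N w i j = 0 := by
      have : Torus.reprSym ((w i).1 - (w j).1) = 0 := hn
      simp [dE, reflectVel, this]
    simp [h1, h2]
  -- write the pre-collisional velocity as `v_i − Δv_i`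
  have hpre : (reflectVel ((Torus.geometry (Fin 3)).sepVec (w i).1 (w j).1) ((w i).2, (w j).2)).1 =
      (w i).2 - dV N w i j := by
    simp only [dV]; abel
  have hω : ‖omg N w i j‖ = 1 := norm_omg hn
  set c : ℝ := ⟪(w i).2 - (w j).2, omg N w i j⟫_ℝ with hc
  have hdv : dV N w i j = c • omg N w i j := dV_eq_smul_omg w i j
  simp only [dE, hpre, hdv, Vcm]
  rw [norm_sub_sq_real, norm_smul, hω, mul_one, Real.norm_eq_abs, sq_abs, inner_smul_right,
    inner_smul_left, inner_add_left]
  have hg : ⟪(w i).2, omg N w i j⟫_ℝ - ⟪(w j).2, omg N w i j⟫_ℝ = c := by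
    rw [hc, inner_sub_left]
  simp only [RCLike.conj_to_real]
  linear_combination (c / 2) * hg

/-- Positions of a pair differ by the separation vector: `x_i = x_j + proj n`. -/
theorem fst_eq_fst_add_proj_sepV : (w i).1 = (w j).1 + Torus.proj (sepV N w i j) := by
  rw [sepV, Torus.geometry_sepVec, Torus.proj_reprSym]
  abel

variable {w i j}

/-- For a pair at minimal-image distance `< 1/2` the separation vector is odd under swapping. -/
theorem sepV_swap (h : ‖sepV N w i j‖ < 2⁻¹) : sepV N w j i = -sepV N w i j :=
  (Torus.isHardSphereRegular_geometry h).sepVec_comm (w i).1 (w j).1 le_rfl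

/-- Hence the unit normal is odd under swapping. -/
theorem omg_swap (h : ‖sepV N w i j‖ < 2⁻¹) : omg N w j i = -omg N w i j := by
  rw [omg, omg, sepV_swap h, norm_neg, smul_neg]

/-- Momentum conservation in the pair: `Δv_j = −Δv_i`. -/
theorem dV_swap (h : ‖sepV N w i j‖ < 2⁻¹) : dV N w j i = -dV N w i j := by
  rw [dV_eq_smul_omg, dV_eq_smul_omg, omg_swap h, inner_neg_right, ← neg_sub (w i).2,
    inner_neg_left, neg_neg, smul_neg]

/-- `‖Δv_j‖ = ‖Δv_i‖`. -/
theorem norm_dV_swap (h : ‖sepV N w i j‖ < 2⁻¹) : ‖dV N w j i‖ = ‖dV N w i j‖ := by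
  rw [dV_swap h, norm_neg]

/-- Energy conservation in the pair: `Δ(|v_j|²/2) = −Δ(|v_i|²/2)`. -/
theorem dE_swap (h : ‖sepV N w i j‖ < 2⁻¹) : dE N w j i = -dE N w i j := by
  rw [dE_eq_mul_inner, dE_eq_mul_inner, omg_swap h, Vcm_swap, inner_neg_right, inner_neg_right,
    ← neg_sub (w i).2, inner_neg_left]
  ring

/-- **The jump of the PAIR.** For an ordered pair at minimal-image distance `< 1/2`, the two ordered
jump kernels add up to `⟪g, ω⟫ (⟪ψ(x_i) − ψ(x_j), ω⟫ + (χ(x_i) − χ(x_j)) ⟪V, ω⟫)`. -/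
theorem jumpK_add_jumpK_swap' (h : ‖sepV N w i j‖ < 2⁻¹) (ψ : ℝ → T3 → V3) (χ : ℝ → T3 → ℝ) (s : ℝ) :
    jumpK ψ χ N s w i j + jumpK ψ χ N s w j i =
      ⟪(w i).2 - (w j).2, omg N w i j⟫_ℝ *
        (⟪ψ s (w i).1 - ψ s (w j).1, omg N w i j⟫_ℝ + (χ s (w i).1 - χ s (w j).1) * ⟪Vcm N w i j, omg N w i j⟫_ℝ) := by
  simp only [jumpK, dV_swap h, dE_swap h, dE_eq_mul_inner, dV_eq_smul_omg, inner_neg_right,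
    inner_smul_right, inner_sub_left]
  ring

/-- **The mark of the PAIR.** The two ordered flux-form marks add up to
`(ε/2)‖Δv_i‖ (m(x_i) + m(x_j))`, `m(x) = ω⊗ω : ∇ψ(x) + (V·ω)(ω·∇χ(x))` (the mark factor is even in `ω`). -/
theorem markK_add_markK_swap (h : ‖sepV N w i j‖ < 2⁻¹) (σ : ℝ) (ψ : ℝ → T3 → V3) (χ : ℝ → T3 → ℝ)
    (s : ℝ) :
    markK σ ψ χ N s w i j + markK σ ψ χ N s w j i =
      hsDiameter σ N / 2 * ‖dV N w i j‖ *
        (((∑ a, ∑ b, omg N w i j a * omg N w i j b * gradPsi ψ s (w i).1 a b) +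
            ⟪Vcm N w i j, omg N w i j⟫_ℝ * ∑ a, omg N w i j a * gradChi χ s (w i).1 a) +
          ((∑ a, ∑ b, omg N w i j a * omg N w i j b * gradPsi ψ s (w j).1 a b) +
            ⟪Vcm N w i j, omg N w i j⟫_ℝ * ∑ a, omg N w i j a * gradChi χ s (w j).1 a)) := by
  simp only [markK, norm_dV_swap h, omg_swap h, Vcm_swap, PiLp.neg_apply, inner_neg_right,
    neg_mul, mul_neg, neg_neg, Finset.sum_neg_distrib]
  ring

end PairKinematics

/-- **Registered stub `jumpK_add_jumpK_swap` — THE JUMP OF THE PAIR.** For an ordered pair at minimal-image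
distance `< 1/2`, the two ordered jump kernels of the crux's observable add up to
`⟪g, ω⟫ (⟪ψ(x_i) − ψ(x_j), ω⟫ + (χ(x_i) − χ(x_j)) ⟪V, ω⟫)` — momentum and energy conservation in the pair turn the two
one-particle jumps into FINITE DIFFERENCES of the tests across the contact (Spohn 1991 I §3.2; the `ε(ω·∇)` of
Enskog's collisional transfer before the Taylor step). [folklore] -/
theorem jumpK_add_jumpK_swap : ∀ {N : ℕ} {w : Cfg N} {i j : Fin (N + 1)}, ‖sepV N w i j‖ < 2⁻¹ → ∀ (ψ : ℝ → T3 → V3) (χ : ℝ → T3 → ℝ) (s : ℝ), jumpK ψ χ N s w i j + jumpK ψ χ N s w j i = ⟪(w i).2 - (w j).2, omg N w i j⟫_ℝ * (⟪ψ s (w i).1 - ψ s (w j).1, omg N w i j⟫_ℝ + (χ s (w i).1 - χ s (w j).1) * ⟪Vcm N w i j, omg N w i j⟫_ℝ) :=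
  fun h ψ χ s => jumpK_add_jumpK_swap' h ψ χ s


end

end Summit.AtomisticToContinuum.HydrodynamicLimit.Theorems.HemisphereAffineSlaving
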